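import Summits.AtomisticToContinuum.Crystallization.Theorems.FrustratedLawDichotomyCappedRigidityCertPatterns

/-!
# FrustratedLawDichotomy · crux `AperiodicFrustratedLawGap` (stmt-AtomisticToContinuum-27623) — THE INDEX STRUCTURE OF THE FINITE PROBLEM:
# exact contact / square / cap combinatorics of the fcc and hcp kissing patterns, by `decide` on the integer models (decomp-a2c, prover hand 2, gen 9)

The finite certificate targets `CappedCert` / `CoarseCert` / `BasinCert` (p820515, p820984) and lens-5's cells (`TetraCellAt`, `OctaCellAt`,
`FrameAssemblyAt`, p820618) quantify over pattern pairs by METRIC predicates: contacts `dist u v = 1`, square diagonals `dist u v = √2`,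
square vertices `w = a ∨ w = b ∨ (dist w a = 1 ∧ dist w b = 1)`.  A certificate replay (and the P / cell provers) needs these as an
explicit finite index structure.  Through `dist_eq_one_iff_sqNormInt` / `dist_eq_sqrt_two_iff_sqNormInt` (p820589: in the scaled integer
pattern `{v/√N}`, contact ⟺ `sqNormInt (v − w) = N`, diagonal ⟺ `= 2N`; `N = 2` for `fccInt`, `N = 18` for `hcpInt`) everything reduces
to integer arithmetic on `fccInt` / `hcpInt`, checked here by `decide`:

* distance spectrum: `sqNormInt (v − w) ∈ {0, 2, 4, 6, 8}` (fcc: `0, 1, √2, √3, 2` in contact units) / `∈ {0, 18, 36, 48, 54, 66, 72}` (hcp: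
  `0, 1, √2, √(8/3), √3, √(11/3), 2`);
* every point has exactly FOUR contacts and exactly TWO diagonal partners (the link is 4-regular; every vertex lies in two squares — cubocta
  `3.4.3.4`, anticubocta `3.4.3.4` / `3.3.4.4`);
* every diagonal pair `{v, w}` has exactly TWO common contacts (the other two vertices of its square);
* the integer CAP `v + w` of a diagonal pair has `sqNormInt = 2N` (norm `√2` in contact units) and is in contact with EXACTLY the four
  vertices of the square: `sqNormInt (v + w − z) = N ⟺ z = v ∨ z = w ∨ (z touches v and w)` — the exact-pattern counterpart of `Capped`'s
  vertex clause, and the reason the ideal cap `A(a + b)` is the reference point of lens-5's `OctaCellAt` / `CappedRigidityBothAt`.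
`[folklore]` (finite computation); def-free; no `sorry`; `decide` only (no `native_decide`).
-/

namespace Summit.AtomisticToContinuum.Crystallization.Theorems.FrustratedLawDichotomyKissingPatternCombinatorics

open Literature.Geometry.DiscreteGeometry

set_option maxRecDepth 8000

/-! ### fcc (`fccInt`, contact ⟺ `sqNormInt = 2`, diagonal ⟺ `= 4`) -/

/-- fcc distance spectrum: squared integer distances `∈ {0, 2, 4, 6, 8}`. [folklore] -/
theorem fccInt_sqNormInt_sub_mem : ∀ v ∈ fccInt, ∀ w ∈ fccInt,
    sqNormInt (v - w) = 0 ∨ sqNormInt (v - w) = 2 ∨ sqNormInt (v - w) = 4 ∨ sqNormInt (v - w) = 6 ∨ sqNormInt (v - w) = 8 := by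
  decide

/-- fcc: every point has exactly four contacts (the link is 4-regular). [folklore] -/
theorem fccInt_card_contacts : ∀ v ∈ fccInt, (fccInt.filter (fun w => sqNormInt (v - w) = 2)).card = 4 := by decide

/-- fcc: every point has exactly two diagonal partners (lies in two squares). [folklore] -/
theorem fccInt_card_diagonals : ∀ v ∈ fccInt, (fccInt.filter (fun w => sqNormInt (v - w) = 4)).card = 2 := by decide

/-- fcc: a diagonal pair has exactly two common contacts (the other two vertices of its square). [folklore] -/
theorem fccInt_card_common_contacts_of_diagonal : ∀ v ∈ fccInt, ∀ w ∈ fccInt, sqNormInt (v - w) = 4 →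
    (fccInt.filter (fun z => sqNormInt (v - z) = 2 ∧ sqNormInt (w - z) = 2)).card = 2 := by
  decide

/-- fcc: the integer cap `v + w` of a diagonal pair has `sqNormInt = 4` (norm `√2` in contact units). [folklore] -/
theorem fccInt_sqNormInt_cap : ∀ v ∈ fccInt, ∀ w ∈ fccInt, sqNormInt (v - w) = 4 → sqNormInt (v + w) = 4 := by decide

/-- fcc: the cap `v + w` of a diagonal pair is in contact with EXACTLY the four vertices of the square. [folklore] -/
theorem fccInt_cap_contacts_iff : ∀ v ∈ fccInt, ∀ w ∈ fccInt, sqNormInt (v - w) = 4 → ∀ z ∈ fccInt,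
    (sqNormInt (v + w - z) = 2 ↔ (z = v ∨ z = w ∨ (sqNormInt (z - v) = 2 ∧ sqNormInt (z - w) = 2))) := by
  decide

/-- fcc: the cap of a diagonal pair is not a pattern point (it lies in the second shell). [folklore] -/
theorem fccInt_cap_not_mem : ∀ v ∈ fccInt, ∀ w ∈ fccInt, sqNormInt (v - w) = 4 → v + w ∉ fccInt := by decide

/-! ### hcp (`hcpInt`, contact ⟺ `sqNormInt = 18`, diagonal ⟺ `= 36`) -/

/-- hcp distance spectrum: squared integer distances `∈ {0, 18, 36, 48, 54, 66, 72}`. [folklore] -/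
theorem hcpInt_sqNormInt_sub_mem : ∀ v ∈ hcpInt, ∀ w ∈ hcpInt,
    sqNormInt (v - w) = 0 ∨ sqNormInt (v - w) = 18 ∨ sqNormInt (v - w) = 36 ∨ sqNormInt (v - w) = 48 ∨
      sqNormInt (v - w) = 54 ∨ sqNormInt (v - w) = 66 ∨ sqNormInt (v - w) = 72 := by
  decide

/-- hcp: every point has exactly four contacts. [folklore] -/
theorem hcpInt_card_contacts : ∀ v ∈ hcpInt, (hcpInt.filter (fun w => sqNormInt (v - w) = 18)).card = 4 := by decide

/-- hcp: every point has exactly two diagonal partners. [folklore] -/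
theorem hcpInt_card_diagonals : ∀ v ∈ hcpInt, (hcpInt.filter (fun w => sqNormInt (v - w) = 36)).card = 2 := by decide

/-- hcp: a diagonal pair has exactly two common contacts. [folklore] -/
theorem hcpInt_card_common_contacts_of_diagonal : ∀ v ∈ hcpInt, ∀ w ∈ hcpInt, sqNormInt (v - w) = 36 →
    (hcpInt.filter (fun z => sqNormInt (v - z) = 18 ∧ sqNormInt (w - z) = 18)).card = 2 := by
  decide

/-- hcp: the integer cap `v + w` of a diagonal pair has `sqNormInt = 36`. [folklore] -/
theorem hcpInt_sqNormInt_cap : ∀ v ∈ hcpInt, ∀ w ∈ hcpInt, sqNormInt (v - w) = 36 → sqNormInt (v + w) = 36 := by decide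

/-- hcp: the cap `v + w` of a diagonal pair is in contact with EXACTLY the four vertices of the square. [folklore] -/
theorem hcpInt_cap_contacts_iff : ∀ v ∈ hcpInt, ∀ w ∈ hcpInt, sqNormInt (v - w) = 36 → ∀ z ∈ hcpInt,
    (sqNormInt (v + w - z) = 18 ↔ (z = v ∨ z = w ∨ (sqNormInt (z - v) = 18 ∧ sqNormInt (z - w) = 18))) := by
  decide

/-- hcp: the cap of a diagonal pair is not a pattern point. [folklore] -/
theorem hcpInt_cap_not_mem : ∀ v ∈ hcpInt, ∀ w ∈ hcpInt, sqNormInt (v - w) = 36 → v + w ∉ hcpInt := by decide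

/-! ### The metric reading (through p820589's `dist_eq_one_iff_sqNormInt` / `dist_eq_sqrt_two_iff_sqNormInt`) -/

/-- **fcc, metric form: every point of the fcc kissing pattern has a contact** (so `LinkIso` forces at least one link bond at every `τ u`).
[folklore] -/
theorem fcc_exists_contact : ∀ u : ↥fccKissingPattern, ∃ w : ↥fccKissingPattern,
    dist (u : EuclideanSpace ℝ (Fin 3)) (w : EuclideanSpace ℝ (Fin 3)) = 1 := by
  intro u
  have hu := u.2
  simp only [fccKissingPattern, scaledPattern, Finset.mem_image] at hu
  obtain ⟨v, hv, hvu⟩ := hu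
  have h4 := fccInt_card_contacts v hv
  obtain ⟨z, hz⟩ : (fccInt.filter (fun w => sqNormInt (v - w) = 2)).Nonempty := by
    rw [← Finset.card_pos, h4]; norm_num
  rw [Finset.mem_filter] at hz
  have hzmem : ((Real.sqrt (2 : ℕ))⁻¹ • intVec z : EuclideanSpace ℝ (Fin 3)) ∈ fccKissingPattern := by
    simp only [fccKissingPattern, scaledPattern, Finset.mem_image]
    exact ⟨z, hz.1, rfl⟩
  refine ⟨⟨_, hzmem⟩, ?_⟩
  show dist (u : EuclideanSpace ℝ (Fin 3)) ((Real.sqrt (2 : ℕ))⁻¹ • intVec z) = 1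
  rw [← hvu]
  exact (FrustratedLawDichotomyCappedRigidityCertPatterns.dist_eq_one_iff_sqNormInt two_ne_zero v z).2 (by exact_mod_cast hz.2)

/-- **hcp, metric form: every point of the hcp kissing pattern has a contact.** [folklore] -/
theorem hcp_exists_contact : ∀ u : ↥hcpKissingPattern, ∃ w : ↥hcpKissingPattern,
    dist (u : EuclideanSpace ℝ (Fin 3)) (w : EuclideanSpace ℝ (Fin 3)) = 1 := by
  intro u
  have hu := u.2
  simp only [hcpKissingPattern, scaledPattern, Finset.mem_image] at hu
  obtain ⟨v, hv, hvu⟩ := hu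
  have h4 := hcpInt_card_contacts v hv
  obtain ⟨z, hz⟩ : (hcpInt.filter (fun w => sqNormInt (v - w) = 18)).Nonempty := by
    rw [← Finset.card_pos, h4]; norm_num
  rw [Finset.mem_filter] at hz
  have hzmem : ((Real.sqrt (18 : ℕ))⁻¹ • intVec z : EuclideanSpace ℝ (Fin 3)) ∈ hcpKissingPattern := by
    simp only [hcpKissingPattern, scaledPattern, Finset.mem_image]
    exact ⟨z, hz.1, rfl⟩
  refine ⟨⟨_, hzmem⟩, ?_⟩
  show dist (u : EuclideanSpace ℝ (Fin 3)) ((Real.sqrt (18 : ℕ))⁻¹ • intVec z) = 1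
  rw [← hvu]
  exact (FrustratedLawDichotomyCappedRigidityCertPatterns.dist_eq_one_iff_sqNormInt (by norm_num) v z).2
    (by exact_mod_cast hz.2)

end Summit.AtomisticToContinuum.Crystallization.Theorems.FrustratedLawDichotomyKissingPatternCombinatorics
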